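import Summits.ResolutionOfSingularities.ResolutionOfSingularities.Theorems.FrobeniusClosingPatchingRelPerfectDepthGradedTargets
import Summits.ResolutionOfSingularities.ResolutionOfSingularities.Theorems.FrobeniusClosingPatchingRelPerfectDepthSingleFormBasics
import Literature.AlgebraicGeometry.Motives.ProjectiveSpaceDehomogenize
import Literature.AlgebraicGeometry.Motives.SegreEmbedding
import Literature.AlgebraicGeometry.Resolution.ProjectiveSpaceRegular
import Mathlib.RingTheory.Ideal.Quotient.Nilpotent
import HarnessLib

/-!
# Crux `PatchingRelPerfect` (stmt-ResolutionOfSingularities-16161), chain W5.2 — TargetsF5J hand (a):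
# the zero scheme `V₊(P) ⊂ ℙ^m_{κ₀}` of ONE SQUAREFREE form is reduced

[OURS · L1 W5.2 · TargetsF5J support] plan-1 g7 HANDS 2026-08-27T08:22:43Z, object (a) for res-type-003:
`isReduced_subscheme_formsIdealSheaf_of_squarefree` — the member hypothesis `hred : IsReduced (K.comap i).subscheme` of
`mixedEngineJTwo_threefold` (TargetsF5J v5.1, compositions) for ONE-FORM graded members, whose E-side datum is
`K|_E = formsIdealSheaf κ₀ m d P hP = (P₀)~` (F4 `…DepthGradedTargets`, (D) package `gradedHostPackagePow`).

CONTENT. For a field `κ₀`, `m d : ℕ` and one form `P₀ ∈ κ₀[T₀,…,T_m]` of degree `d` which is SQUAREFREE, the closed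
subscheme of `ℙ^m_{κ₀}` cut out by the ideal sheaf `(P₀)~` (tree `projIdealSheaf`) is reduced:

* `squarefree_dehomogenize` — dehomogenisation `α = (· )(T_l := 1)` preserves squarefreeness of homogeneous polynomials
  (Hartshorne I, proof of Prop. 2.2 / Ex. 2.10: `α`, `β` respect products; if `p² ∣ α(P₀)` with `p` irreducible, lift
  `p`, the cofactor to forms (`β`, `exists_isHomogeneous_dehomogenize_eq`), compare by `eq_of_dehomogenize_eq`, and pick a
  prime factor `q` of the lift with `α(q)` a non-unit (`exists_irreducible_dvd_not_isUnit_map`); then `q ∤ T_l`, so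
  `q² ∣ P₀ · T_l^N` forces `q² ∣ P₀`);
* `isReduced_chartQuotient` — over the chart `D₊(T_l) ≅ Spec κ₀[y₁,…,y_m]` (`ProjectiveSpace.chartAlgEquiv`) the ideal
  is generated by `α(P₀)` (`DepthTargets.projIdealSheaf_single_ideal_basicOpen`, p506283), which is squarefree, hence radical in the
  factorial ring `κ₀[y]` (`Squarefree.isRadical`), so the quotient is reduced;
* `isReduced_subscheme_projIdealSheaf_single_of_squarefree` — reducedness is local and the `D₊(T_l)` cover `ℙ^m`
  (Mathlib `Scheme.IdealSheafData.subschemeCover`);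
* `isReduced_subscheme_formsIdealSheaf_of_squarefree` — the same in the F4 spelling `formsIdealSheaf` (by `rfl`).

Fact-free; folklore. Nothing here is a statement of the manuscript under review (AI-typed, weaker than expert review).

## References
* R. Hartshorne, *Algebraic Geometry* (1977), I §2 proof of Prop. 2.2 and Ex. 2.10 (dehomogenisation and products),
  II Prop. 5.9 / 5.11 (b) and Ex. 3.12 (ideal sheaves of homogeneous ideals). [Hartshorne1977]
-/

-- `Summit.<Summit>.<Sub>.Theorems` with `Sub = Summit` (single-conjunct summit, D-0017)
set_option linter.dupNamespace false

noncomputable section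

open CategoryTheory AlgebraicGeometry TopologicalSpace HomogeneousLocalization MvPolynomial
open Literature.AlgebraicGeometry.Resolution Literature.AlgebraicGeometry.Motives
open Literature.AlgebraicGeometry.Motives.ProjectiveSpace

namespace Summit.ResolutionOfSingularities.ResolutionOfSingularities.Theorems.DepthForms

universe u

/-! ## §1 Dehomogenisation preserves squarefreeness -/

/-- In a monoid with well-founded divisibility, a non-zero element whose image under a monoid homomorphism `φ` is
not a unit has an irreducible factor whose image is not a unit (induction on irreducible factorisations).
[folklore] -/
theorem exists_irreducible_dvd_not_isUnit_map {α β F : Type*} [CommMonoidWithZero α] [WfDvdMonoid α]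
    [Monoid β] [FunLike F α β] [MonoidHomClass F α β] (φ : F) {a : α} (ha : a ≠ 0)
    (hφ : ¬ IsUnit (φ a)) : ∃ q : α, Irreducible q ∧ q ∣ a ∧ ¬ IsUnit (φ q) := by
  induction a using WfDvdMonoid.induction_on_irreducible with
  | zero => exact (ha rfl).elim
  | unit u hu => exact (hφ (hu.map φ)).elim
  | mul a i ha0 hi ih =>
    by_cases hiu : IsUnit (φ i)
    · have hau : ¬ IsUnit (φ a) := fun hau => hφ (by rw [map_mul]; exact hiu.mul hau)
      obtain ⟨q, hq, hqa, hqu⟩ := ih ha0 hau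
      exact ⟨q, hq, hqa.mul_left i, hqu⟩
    · exact ⟨i, hi, dvd_mul_right i a, hiu⟩

/-- **Dehomogenisation preserves squarefreeness** (over a field): if `F ∈ k[x₀,…,xₙ]` is a squarefree form, then
`α(F) = F(xᵢ := 1)` is squarefree. If `p² ∣ α(F)` with `p` irreducible, write `α(F) = p² h`, lift `p, h` to forms
`G, H` (`β`), so that `G² H xᵢᵈ = F xᵢ^N` (both forms of the same degree with the same image under `α`); a prime factor
`q` of `G` with `α(q)` a non-unit does not divide `xᵢ`, hence `q² ∣ F`, contradicting squarefreeness.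
[cite: Hartshorne1977, I §2, proof of Prop. 2.2 and Ex. 2.10] -/
theorem squarefree_dehomogenize {k : Type u} [Field k] {n : ℕ} (i : Fin (n + 1)) {d : ℕ}
    {F : MvPolynomial (Fin (n + 1)) k} (hF : F.IsHomogeneous d) (hsq : Squarefree F) :
    Squarefree (dehomogenize k i F) := by
  classical
  have hF0 : F ≠ 0 := hsq.ne_zero
  have hf0 : dehomogenize k i F ≠ 0 := fun h0 =>
    hF0 (eq_of_dehomogenize_eq i hF (isHomogeneous_zero _ _ d) (by rw [h0, map_zero]))
  rw [squarefree_iff_irreducible_sq_not_dvd_of_ne_zero hf0]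
  rintro p hp ⟨h, hph⟩
  obtain ⟨G, hG, hGp⟩ := exists_isHomogeneous_dehomogenize_eq k i p le_rfl
  obtain ⟨H, hH, hHh⟩ := exists_isHomogeneous_dehomogenize_eq k i h le_rfl
  have hX1 : (X i : MvPolynomial (Fin (n + 1)) k).IsHomogeneous 1 := isHomogeneous_X k i
  -- `G² H xᵢᵈ = F xᵢ^N`
  have key : G * G * H * X i ^ d = F * X i ^ (p.totalDegree + p.totalDegree + h.totalDegree) := by
    refine eq_of_dehomogenize_eq i (e := p.totalDegree + p.totalDegree + h.totalDegree + 1 * d) ?_ ?_ ?_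
    · exact ((hG.mul hG).mul hH).mul (hX1.pow d)
    · have e1 : d + 1 * (p.totalDegree + p.totalDegree + h.totalDegree) =
          p.totalDegree + p.totalDegree + h.totalDegree + 1 * d := by ring
      exact e1 ▸ hF.mul (hX1.pow _)
    · simp only [map_mul, map_pow, dehomogenize_X_self, one_pow, mul_one, hGp, hHh]
      exact hph.symm
  -- a prime factor `q` of `G` whose dehomogenisation is not a unit
  have hG0 : G ≠ 0 := by
    rintro rfl
    exact hp.ne_zero (by rw [← hGp, map_zero])
  have hGu : ¬ IsUnit (dehomogenize k i G) := by
    rw [hGp]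
    exact hp.not_isUnit
  obtain ⟨q, hq, hqG, hqu⟩ := exists_irreducible_dvd_not_isUnit_map (dehomogenize k i) hG0 hGu
  have hqprime : Prime q := hq.prime
  -- `q ∤ xᵢ`: otherwise `α(q)` divides `α(xᵢ) = 1`
  have hqX : ¬ q ∣ X i := by
    rintro ⟨r, hr⟩
    apply hqu
    have h1 : dehomogenize k i q * dehomogenize k i r = 1 := by
      rw [← map_mul, ← hr, dehomogenize_X_self]
    exact IsUnit.of_mul_eq_one _ h1
  -- hence `q² ∣ F`
  have hq2' : q ^ 2 ∣ F * X i ^ (p.totalDegree + p.totalDegree + h.totalDegree) := by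
    rw [← key, sq]
    exact ((mul_dvd_mul hqG hqG).mul_right H).mul_right _
  have hq2 : q ^ 2 ∣ F :=
    hqprime.pow_dvd_of_dvd_mul_right 2 (fun hdvd => hqX (hqprime.dvd_of_dvd_pow hdvd)) hq2'
  exact hq.not_isUnit (hsq q (by simpa only [sq] using hq2))

/-! ## §2 The chart quotient `κ₀[y₁,…,y_m] ⧸ (α(P₀))` is reduced -/

attribute [local instance] MvPolynomial.gradedAlgebra

/-- The chart isomorphism `(κ₀[T]_{T_l})₀ ≅ κ₀[y₁,…,y_m]` sends the generator `a/T_lⁿ` (`mk₁`) to the dehomogenised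
form `a(T_l := 1)`. [folklore] -/
theorem chartAlgEquiv_mk₁ (κ₀ : Type u) [Field κ₀] {m : ℕ} (l : Fin (m + 1)) (n : ℕ)
    (a : MvPolynomial (Fin (m + 1)) κ₀) (ha : a ∈ MvPolynomial.homogeneousSubmodule (Fin (m + 1)) κ₀ n) :
    chartAlgEquiv κ₀ l (mk₁ (MvPolynomial.homogeneousSubmodule (Fin (m + 1)) κ₀)
      (MvPolynomial.isHomogeneous_X κ₀ l) n a ha) = dehomogenize κ₀ l a :=
  ofChartRingHom_mk l n a _

/-- **Over the chart `D₊(T_l)`, the quotient of the ring of sections by the form ideal of ONE squarefree form is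
reduced**: through `D₊(T_l) ≅ Spec κ₀[y₁,…,y_m]` the ideal is generated by the squarefree polynomial `P₀(T_l := 1)`,
which is radical in the factorial ring `κ₀[y]`. [cite: Hartshorne1977, II Prop. 5.11 (b)] -/
theorem isReduced_chartQuotient (κ₀ : Type u) [Field κ₀] (m d : ℕ)
    (P : Fin 1 → MvPolynomial (Fin (m + 1)) κ₀)
    (hP : ∀ j, P j ∈ MvPolynomial.homogeneousSubmodule (Fin (m + 1)) κ₀ d) (hsq : Squarefree (P 0))
    (l : Fin (m + 1)) :
    IsReduced (Γ(Proj (MvPolynomial.homogeneousSubmodule (Fin (m + 1)) κ₀),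
        Proj.basicOpen (MvPolynomial.homogeneousSubmodule (Fin (m + 1)) κ₀) (MvPolynomial.X l)) ⧸
      (projIdealSheaf (MvPolynomial.homogeneousSubmodule (Fin (m + 1)) κ₀)
          ⟨Ideal.span (Set.range P), isHomogeneous_span_of_forall_mem _ P (fun _ => d) hP⟩).ideal
        ⟨Proj.basicOpen (MvPolynomial.homogeneousSubmodule (Fin (m + 1)) κ₀) (MvPolynomial.X l),
          Proj.isAffineOpen_basicOpen _ (MvPolynomial.X l) (MvPolynomial.isHomogeneous_X κ₀ l) one_pos⟩) := by
  set 𝒜 := MvPolynomial.homogeneousSubmodule (Fin (m + 1)) κ₀ with h𝒜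
  have hX : (MvPolynomial.X l : MvPolynomial (Fin (m + 1)) κ₀) ∈ 𝒜 1 := MvPolynomial.isHomogeneous_X κ₀ l
  -- the `κ₀`-algebra structure of the chart ring (the tree's `ProjBaseChange.algebraBase`, as in `chartAlgEquiv`)
  letI : Algebra κ₀ (Away 𝒜 (MvPolynomial.X l)) :=
    ProjBaseChange.algebraBase 𝒜 (Submonoid.powers (MvPolynomial.X l))
  set g : Away 𝒜 (MvPolynomial.X l) := mk₁ 𝒜 hX d (P 0) (hP 0) with hg
  set f : MvPolynomial (Fin m) κ₀ := dehomogenize κ₀ l (P 0) with hf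
  -- the ideal over the chart is generated by the image of `g`
  rw [DepthTargets.projIdealSheaf_single_ideal_basicOpen κ₀ m d P hP l]
  -- `Γ(ℙ^m, D₊(T_l)) ≅ (κ₀[T]_{T_l})₀`
  let eA : CommRingCat.of (Away 𝒜 (MvPolynomial.X l)) ≅ Γ(Proj 𝒜, Proj.basicOpen 𝒜 (MvPolynomial.X l)) :=
    Proj.basicOpenIsoAway 𝒜 (MvPolynomial.X l) hX one_pos
  have h1 : Ideal.span {(Proj.awayToSection 𝒜 (MvPolynomial.X l)).hom g} =
      (Ideal.span {g}).map (eA.commRingCatIsoToRingEquiv : Away 𝒜 (MvPolynomial.X l) →+* _) := by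
    rw [Ideal.map_span, Set.image_singleton]
    rfl
  -- `(κ₀[T]_{T_l})₀ ≅ κ₀[y₁,…,y_m]`, `g ↦ f`
  have h2 : Ideal.span {f} =
      (Ideal.span {g}).map ((chartAlgEquiv κ₀ l).toRingEquiv : Away 𝒜 (MvPolynomial.X l) →+* _) := by
    rw [Ideal.map_span, Set.image_singleton]
    congr 2
    exact (chartAlgEquiv_mk₁ κ₀ l d (P 0) (hP 0)).symm
  let q₁ := Ideal.quotientEquiv (Ideal.span {g}) _ eA.commRingCatIsoToRingEquiv h1
  let q₂ := Ideal.quotientEquiv (Ideal.span {g}) (Ideal.span {f}) (chartAlgEquiv κ₀ l).toRingEquiv h2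
  -- `κ₀[y] ⧸ (f)` is reduced since `f` is squarefree
  haveI : IsReduced (MvPolynomial (Fin m) κ₀ ⧸ Ideal.span {f}) :=
    (Ideal.isRadical_iff_quotient_reduced _).mp
      (isRadical_iff_span_singleton.mp (squarefree_dehomogenize l (hP 0) hsq).isRadical)
  haveI : IsReduced (Away 𝒜 (MvPolynomial.X l) ⧸ Ideal.span {g}) := isReduced_of_injective q₂ q₂.injective
  exact isReduced_of_injective q₁.symm q₁.symm.injective

end Summit.ResolutionOfSingularities.ResolutionOfSingularities.Theorems.DepthForms

/-! ## §3 `V₊(P₀) ⊂ ℙ^m_{κ₀}` is reduced for a squarefree form -/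

namespace Summit.ResolutionOfSingularities.ResolutionOfSingularities.Theorems.DepthTargets

universe u

attribute [local instance] MvPolynomial.gradedAlgebra

/-- **The closed subscheme of `ℙ^m_{κ₀}` cut out by the form ideal sheaf `(P₀)~` of ONE SQUAREFREE form is reduced**:
reducedness is local, the standard charts `D₊(T_l)` cover `ℙ^m`, and over each of them the subscheme is
`Spec (κ₀[y₁,…,y_m] ⧸ (P₀(T_l := 1)))` with `P₀(T_l := 1)` squarefree (`DepthForms.isReduced_chartQuotient`).
[cite: Hartshorne1977, II Prop. 5.9 and Ex. 3.12] -/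
theorem isReduced_subscheme_projIdealSheaf_single_of_squarefree (κ₀ : Type u) [Field κ₀] (m d : ℕ)
    (P : Fin 1 → MvPolynomial (Fin (m + 1)) κ₀)
    (hP : ∀ j, P j ∈ MvPolynomial.homogeneousSubmodule (Fin (m + 1)) κ₀ d) (hsq : Squarefree (P 0)) :
    IsReduced (projIdealSheaf (MvPolynomial.homogeneousSubmodule (Fin (m + 1)) κ₀)
        ⟨Ideal.span (Set.range P), isHomogeneous_span_of_forall_mem _ P (fun _ => d) hP⟩).subscheme := by
  set 𝒜 := MvPolynomial.homogeneousSubmodule (Fin (m + 1)) κ₀ with h𝒜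
  set 𝓟 := projIdealSheaf 𝒜 ⟨Ideal.span (Set.range P), isHomogeneous_span_of_forall_mem _ P (fun _ => d) hP⟩
    with h𝓟
  have hX : ∀ l : Fin (m + 1), (MvPolynomial.X l : MvPolynomial (Fin (m + 1)) κ₀) ∈ 𝒜 1 :=
    fun l => MvPolynomial.isHomogeneous_X κ₀ l
  let U : Fin (m + 1) → (Proj 𝒜).affineOpens := fun l =>
    ⟨Proj.basicOpen 𝒜 (MvPolynomial.X l), Proj.isAffineOpen_basicOpen _ (MvPolynomial.X l) (hX l) one_pos⟩
  refine Scheme.isReduced_of_forall_exists_isOpenImmersion fun x => ?_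
  -- `x` lies over some chart `D₊(T_l)`
  have hcov := Proj.iSup_basicOpen_eq_top 𝒜 (fun l : Fin (m + 1) => (MvPolynomial.X l : MvPolynomial _ κ₀))
    (Segre.irrelevant_le_span_X (Fin (m + 1)) κ₀)
  have hx : 𝓟.subschemeι x ∈
      (⨆ l : Fin (m + 1), Proj.basicOpen 𝒜 (MvPolynomial.X l : MvPolynomial _ κ₀)) := by
    rw [hcov]; trivial
  obtain ⟨l, hl⟩ := Opens.mem_iSup.mp hx
  refine ⟨_, 𝓟.subschemeCover.f (U l), inferInstance, ?_, ?_⟩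
  · have hx' : x ∈ (𝓟.subschemeCover.f (U l)).opensRange := by
      rw [𝓟.opensRange_subschemeCover_map]
      exact hl
    exact hx'
  · haveI := DepthForms.isReduced_chartQuotient κ₀ m d P hP hsq l
    change IsReduced (Spec (.of (Γ(Proj 𝒜, Proj.basicOpen 𝒜 (MvPolynomial.X l)) ⧸ 𝓟.ideal (U l))))
    infer_instance

/-- **Hand (a), by name: the zero scheme of the form ideal sheaf `formsIdealSheaf κ₀ m d P hP` of ONE SQUAREFREE form
is reduced** — the member hypothesis `hred` of `mixedEngineJTwo_threefold` (TargetsF5J) for one-form graded members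
(`K|_E = formsIdealSheaf κ₀ m d P hP` by the (D) package). [cite: Hartshorne1977, II Prop. 5.9 and Ex. 3.12] -/
theorem isReduced_subscheme_formsIdealSheaf_of_squarefree (κ₀ : Type u) [Field κ₀] (m d : ℕ)
    (P : Fin 1 → MvPolynomial (Fin (m + 1)) κ₀)
    (hP : ∀ j, P j ∈ MvPolynomial.homogeneousSubmodule (Fin (m + 1)) κ₀ d) (hsq : Squarefree (P 0)) :
    IsReduced (formsIdealSheaf κ₀ m d P hP).subscheme :=
  isReduced_subscheme_projIdealSheaf_single_of_squarefree κ₀ m d P hP hsq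

end Summit.ResolutionOfSingularities.ResolutionOfSingularities.Theorems.DepthTargets

end
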